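import Literature.NumberTheory.Sieve.MoebiusExpSum
import Literature.NumberTheory.Sieve.FejerKernelCounting
import Literature.NumberTheory.LFunctions.SiegelWalfiszMoebiusProofs
import HarnessLib

/-!
# Davenport's theorem: `∑_{n ≤ N} μ(n) e(nα) ≪_A N (log N)^{-A}` uniformly in `α`

Topic `Literature/NumberTheory/Sieve` (circle method). Everything in this file is PROVED
(theorems only; no definitions, no named facts).

**Davenport's theorem** (H. Davenport, *On some infinite series involving arithmetical
functions (II)*, Quart. J. Math. 8 (1937) 313–320; quoted from Green–Tao, *Quadratic uniformity
of the Möbius function*, Ann. Inst. Fourier 58 (2008) = arXiv:math/0606087, §1 Example 3,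
eq. (mu-alpha): "For any `α ∈ ℝ/ℤ` and for any `A > 0`, we have
`𝔼_{n ∈ [N]} μ(n) e(−αn) ≪_A log^{−A} N`, uniformly in `α ∈ ℝ/ℤ`. This bound is due to Davenport",
proved there in §5 from Props. 10–12; also Iwaniec–Kowalski, *Analytic Number Theory*, §13.5):
for every `A > 0` there is `C = C(A)` with

  `‖∑_{n ≤ N} μ(n) e(nα)‖ ≤ C · N / (log N)^A`   for all `N ≥ 2` and all real `α`

(`MoebiusDavenport.davenport`; the constant is ineffective, through Siegel's theorem). We also
prove the form **restricted to an arithmetic progression**, uniformly in the modulus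
(`MoebiusDavenport.davenport_progression`):

  `‖∑_{n ≤ N, n ≡ r (q)} μ(n) e(nα)‖ ≤ C · N / (log N)^A`  for all `N ≥ 2`, `q ≥ 1`, `r`, `α`,

which follows from the first by expanding the progression into additive characters
(`MoebiusDavenport.sum_filter_mod_eq_sum_twist`, with the tree's orthogonality relation
`RamanujanSum.sum_range_fourierChar_div`).

## Proof (the classical major/minor arc argument, Green–Tao 2008 §5 / IK §13.5)

Dirichlet's theorem with `Q = N/(log N)^B` gives `α = a/q + θ`, `(a, q) = 1`, `q ≤ Q`,
`|θ| ≤ 1/(qQ)`.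
* Minor arcs `q > (log N)^B`: the tree's Davenport–Vaughan bound
  `MoebiusExpSum.norm_afExpSum_moebius_le` (Vaughan's identity),
  `≪ (log N)⁴ (N q^{-1/2} + N^{9/10} + N^{1/2} q^{1/2}) ≪ N (log N)^{4 − B/2}`.
* Major arcs `q ≤ (log N)^B`: split `n` by its residue `r` mod `q` (`e(na/q) = e(ra/q)`), remove
  the slowly varying factor `e(nθ)` by Abel summation (`norm_sum_mul_le_of_lipschitz`; total
  variation `≪ |θ| N ≤ (log N)^B/q`), and bound the partial sums `∑_{n ≤ m, n ≡ r (q)} μ(n)` by the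
  Siegel–Walfisz theorem for `μ` in progressions to ALL residues, PROVED in the tree
  (`Literature.NumberTheory.LFunctions.SiegelWalfiszMoebius_holds`, Montgomery–Vaughan §11.3
  Ex. 13(f)), in its `(log x)^{-B'}` currency `SiegelWalfiszMoebius.logPow`.

## References
* H. Davenport, *On some infinite series involving arithmetical functions (II)*, Quart. J. Math.
  Oxford 8 (1937) 313–320. [Davenport1937]
* B. Green, T. Tao, *Quadratic uniformity of the Möbius function*, Ann. Inst. Fourier 58 (2008)
  1863–1935 = arXiv:math/0606087, §1 Example 3 eq. (mu-alpha), §5 Props. 10–12.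
  [GreenTao2008QuadraticMobius]
* H. Iwaniec, E. Kowalski, *Analytic Number Theory*, AMS Coll. Publ. 53 (2004), §13.5.
  [IwaniecKowalski2004]
-/

noncomputable section

open Finset Real Filter Asymptotics ArithmeticFunction
open scoped FourierTransform ArithmeticFunction.Moebius

namespace Literature.NumberTheory.Sieve.MoebiusDavenport

open Literature.NumberTheory.Sieve.Vinogradov (afExpSum norm_afExpSum_le norm_fourierChar
  norm_fourierChar_sub_one distInt two_mul_distInt_le_abs_sin distInt_le_abs_sub_int half_lt_log)
open Literature.NumberTheory.Sieve.MoebiusExpSum (norm_afExpSum_moebius_le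
  norm_afExpSum_moebius_le_self)
open Literature.NumberTheory.LFunctions (SiegelWalfiszMoebius_holds SiegelWalfiszMoebius.logPow)
open Literature.NumberTheory.Sieve.RamanujanSum (fourierChar_intCast sum_range_fourierChar_div)
open Literature.NumberTheory.Sieve.FejerCounting (fourierChar_add_intCast)

/-! ### Tools: additive characters, Abel summation, growth of logarithms -/

/-- **Detecting a progression with additive characters**: for `q ≥ 1` and any `F`,
`∑_{n ∈ s, n ≡ r (q)} F(n) = q⁻¹ ∑_{c < q} e(−cr/q) ∑_{n ∈ s} F(n) e(cn/q)`.
[cite: GreenTao2008QuadraticMobius, App. A, proof of Corollary 34 (expand 1_{n ≡ a (q)} as a Fourier series)] -/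
theorem sum_filter_mod_eq_sum_twist (s : Finset ℕ) {q : ℕ} (hq : 1 ≤ q) (r : ℕ) (F : ℕ → ℂ) :
    ∑ n ∈ s with n % q = r % q, F n =
      (q : ℂ)⁻¹ * ∑ c ∈ range q, (𝐞 (-((c : ℝ) * ((r : ℝ) / q))) : ℂ) *
        ∑ n ∈ s, F n * (𝐞 ((c : ℝ) * ((n : ℝ) / q)) : ℂ) := by
  have hq0 : (q : ℂ) ≠ 0 := by exact_mod_cast (Nat.one_le_iff_ne_zero.mp hq)
  -- swap the sums and use orthogonality on `x = n - r`
  have hswap : ∑ c ∈ range q, (𝐞 (-((c : ℝ) * ((r : ℝ) / q))) : ℂ) *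
      ∑ n ∈ s, F n * (𝐞 ((c : ℝ) * ((n : ℝ) / q)) : ℂ) =
      ∑ n ∈ s, F n * ∑ c ∈ range q, (𝐞 ((c : ℝ) * (((n : ℤ) - r : ℤ) : ℝ) / q) : ℂ) := by
    simp_rw [Finset.mul_sum]
    rw [Finset.sum_comm]
    refine Finset.sum_congr rfl fun n _ => Finset.sum_congr rfl fun c _ => ?_
    have : (c : ℝ) * (((n : ℤ) - r : ℤ) : ℝ) / q =
        -((c : ℝ) * ((r : ℝ) / q)) + (c : ℝ) * ((n : ℝ) / q) := by push_cast; ring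
    rw [this, AddChar.map_add_eq_mul, Circle.coe_mul]; ring
  rw [hswap]
  have horth : ∀ n ∈ s, F n * ∑ c ∈ range q, (𝐞 ((c : ℝ) * (((n : ℤ) - r : ℤ) : ℝ) / q) : ℂ) =
      if n % q = r % q then F n * q else 0 := by
    intro n _
    rw [sum_range_fourierChar_div (Nat.one_le_iff_ne_zero.mp hq)]
    by_cases h : n % q = r % q
    · have hd : (q : ℤ) ∣ (n : ℤ) - r := (Nat.modEq_iff_dvd).1 (show Nat.ModEq q r n from h.symm)
      rw [if_pos hd, if_pos h]
    · have hd : ¬ (q : ℤ) ∣ (n : ℤ) - r := by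
        intro hd
        exact h ((Nat.modEq_iff_dvd).2 hd).symm
      rw [if_neg hd, if_neg h, mul_zero]
  rw [Finset.sum_congr rfl horth, ← Finset.sum_filter, Finset.mul_sum]
  refine Finset.sum_congr rfl fun n _ => ?_
  field_simp

/-- **Abel summation** on `[1, N]`: with `V(m) = ∑_{n ≤ m} c(n)`,
`∑_{n ≤ N} c(n) g(n) = g(N) V(N) − ∑_{1 ≤ m < N} (g(m+1) − g(m)) V(m)` (the summation by parts
formula of Green–Tao's App. A Lemma 33, on `I = {1, …, N}`).
[cite: GreenTao2008QuadraticMobius, App. A Lemma 33 (summation by parts, the displayed formula)] -/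
theorem sum_Icc_mul_eq_abel (c g : ℕ → ℂ) (N : ℕ) :
    ∑ n ∈ Icc 1 N, c n * g n = g N * (∑ n ∈ Icc 1 N, c n) -
      ∑ m ∈ Ico 1 N, (g (m + 1) - g m) * ∑ n ∈ Icc 1 m, c n := by
  induction N with
  | zero => simp
  | succ N ih =>
    rcases Nat.eq_zero_or_pos N with rfl | hN
    · simp [mul_comm]
    · rw [Finset.sum_Icc_succ_top (by omega), Finset.sum_Icc_succ_top (by omega),
        Finset.sum_Ico_succ_top hN, ih]
      ring

/-- **Abel summation bound for a slowly varying multiplier**: if `‖g(n)‖ ≤ 1` and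
`‖g(m+1) − g(m)‖ ≤ δ` for `1 ≤ m < N`, then
`‖∑_{n ≤ N} c(n) g(n)‖ ≤ ‖V(N)‖ + δ ∑_{1 ≤ m < N} ‖V(m)‖`, `V(m) = ∑_{n ≤ m} c(n)` (a form of
Green–Tao's App. A Lemma 33 `|∑ f ψ| ≤ ‖ψ‖_TV sup_J |∑_J f|`, keeping the individual partial sums).
[cite: GreenTao2008QuadraticMobius, App. A Lemma 33 (summation by parts)] -/
theorem norm_sum_mul_le_of_lipschitz (c g : ℕ → ℂ) (N : ℕ) {δ : ℝ}
    (hg1 : ∀ n, ‖g n‖ ≤ 1) (hg : ∀ m, 1 ≤ m → m < N → ‖g (m + 1) - g m‖ ≤ δ) :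
    ‖∑ n ∈ Icc 1 N, c n * g n‖ ≤
      ‖∑ n ∈ Icc 1 N, c n‖ + δ * ∑ m ∈ Ico 1 N, ‖∑ n ∈ Icc 1 m, c n‖ := by
  rw [sum_Icc_mul_eq_abel]
  refine (norm_sub_le _ _).trans (add_le_add ?_ ?_)
  · rw [norm_mul]
    calc ‖g N‖ * ‖∑ n ∈ Icc 1 N, c n‖ ≤ 1 * ‖∑ n ∈ Icc 1 N, c n‖ :=
          mul_le_mul_of_nonneg_right (hg1 N) (norm_nonneg _)
      _ = _ := one_mul _
  · rw [Finset.mul_sum]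
    refine (norm_sum_le _ _).trans (Finset.sum_le_sum fun m hm => ?_)
    rw [Finset.mem_Ico] at hm
    rw [norm_mul]
    exact mul_le_mul_of_nonneg_right (hg m hm.1 hm.2) (norm_nonneg _)

/-- Powers of `log N` are eventually below any power of `N` (along the naturals). [folklore] -/
private theorem eventually_log_rpow_le_rpow (K : ℝ) {ε : ℝ} (hε : 0 < ε) :
    ∀ᶠ N : ℕ in atTop, Real.log N ^ K ≤ (N : ℝ) ^ ε := by
  have h := ((isLittleO_log_rpow_rpow_atTop K hε).comp_tendsto
    tendsto_natCast_atTop_atTop).bound zero_lt_one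
  filter_upwards [h] with N hN
  have h1 : 0 ≤ Real.log N ^ K := Real.rpow_nonneg (Real.log_natCast_nonneg N) K
  have h2 : 0 ≤ (N : ℝ) ^ ε := Real.rpow_nonneg (Nat.cast_nonneg N) ε
  simpa [Function.comp, Real.norm_of_nonneg h1, Real.norm_of_nonneg h2] using hN

/-- `log N` is eventually `≥ c` (along the naturals). [folklore] -/
private theorem eventually_le_log (c : ℝ) : ∀ᶠ N : ℕ in atTop, c ≤ Real.log N :=
  (Real.tendsto_log_atTop.comp tendsto_natCast_atTop_atTop).eventually_ge_atTop c

/-! ### The phase `e(nα)` on a major arc: residues mod `q` and the slowly varying factor -/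

/-- On `n ≡ r (q)` the phase `e(na/q)` is `e(ra/q)`: for `α = a/q + θ`,
`e(nα) = e((n mod q) a/q) · e(nθ)`. [folklore] -/
private theorem fourierChar_mul_rat_add (n : ℕ) {q : ℕ} (hq : 1 ≤ q) (a : ℤ) (θ : ℝ) :
    (𝐞 ((n : ℝ) * ((a : ℝ) / q + θ)) : ℂ) =
      (𝐞 (((n % q : ℕ) : ℝ) * ((a : ℝ) / q)) : ℂ) * (𝐞 ((n : ℝ) * θ) : ℂ) := by
  have hq0 : (q : ℝ) ≠ 0 := by exact_mod_cast (Nat.one_le_iff_ne_zero.mp hq)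
  have hn : (n : ℝ) = q * ((n / q : ℕ) : ℝ) + ((n % q : ℕ) : ℝ) := by
    exact_mod_cast (Nat.div_add_mod n q).symm
  have hint : (((n / q : ℕ) : ℝ) * (a : ℝ)) = (((n / q : ℕ) * a : ℤ) : ℝ) := by
    rw [Int.cast_mul, Int.cast_natCast]
  have : (n : ℝ) * ((a : ℝ) / q + θ) =
      (((n % q : ℕ) : ℝ) * ((a : ℝ) / q) + (n : ℝ) * θ) + (((n / q : ℕ) : ℝ) * (a : ℝ)) := by
    rw [hn]; field_simp; ring
  rw [this, hint, fourierChar_add_intCast, AddChar.map_add_eq_mul, Circle.coe_mul]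

/-- `‖e((m+1)θ) − e(mθ)‖ ≤ 2π|θ|`. [folklore] -/
private theorem norm_fourierChar_succ_sub_le (m : ℕ) (θ : ℝ) :
    ‖(𝐞 (((m + 1 : ℕ) : ℝ) * θ) : ℂ) - (𝐞 ((m : ℝ) * θ) : ℂ)‖ ≤ 2 * π * |θ| := by
  have h1 : (((m + 1 : ℕ) : ℝ) * θ) = (m : ℝ) * θ + θ := by push_cast; ring
  rw [h1, AddChar.map_add_eq_mul, Circle.coe_mul, ← mul_sub_one, norm_mul, norm_fourierChar,
    one_mul, norm_fourierChar_sub_one]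
  have : |Real.sin (π * θ)| ≤ |π * θ| := Real.abs_sin_le_abs
  rw [abs_mul, abs_of_pos Real.pi_pos] at this
  linarith

/-! ### The major arcs -/

/-- **Major-arc bound** (Davenport; IK §13.5): let `N ≥ 2` with `L = log N ≥ 4`, `1 ≤ q ≤ W`,
`|θ| ≤ W/(Nq)`, and suppose the Siegel–Walfisz bound
`|∑_{n ≤ x, n ≡ r (q')} μ(n)| ≤ C_s x/(log x)^s` holds for `x ≥ 2`, `q' ≤ (log x)^{s_A}` and all
residues, where `W ≤ (L/2)^{s_A}` (so that it applies to our `q` for every `x ≥ √N`). Then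
`‖∑_{n ≤ N} μ(n) e(n(a/q + θ))‖ ≤ (1 + 2π) W (√N + C_s 2^s N/L^s)`.
Proof: split `n` by residues mod `q`, Abel summation against `e(nθ)` (variation `2π|θ|` per
step), Siegel–Walfisz for the partial sums beyond `√N`, trivial bound below `√N` (Green–Tao's
Prop. 12 argues with short intervals instead of Abel summation; same input).
[cite: GreenTao2008QuadraticMobius, §5 Proposition 12 (major arc phases are orthogonal to Möbius)] -/
theorem norm_afExpSum_moebius_majorArc_le {N q : ℕ} {a : ℤ} {θ W Cs s sA : ℝ}
    (hN : 2 ≤ N) (hL4 : 4 ≤ Real.log N) (hq : 1 ≤ q) (hqW : (q : ℝ) ≤ W)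
    (hθ : |θ| ≤ W / (N * q)) (hs : 0 < s) (hsA : 0 < sA) (hCs : 0 ≤ Cs)
    (hWs : W ≤ (Real.log N / 2) ^ sA)
    (hSW : ∀ x : ℝ, 2 ≤ x → ∀ q' : ℕ, 1 ≤ q' → (q' : ℝ) ≤ Real.log x ^ sA → ∀ r : ZMod q',
      |∑ n ∈ (Icc 1 ⌊x⌋₊).filter (fun n : ℕ => (n : ZMod q') = r), (μ n : ℝ)| ≤
        Cs * x / Real.log x ^ s) :
    ‖afExpSum (fun n => (μ n : ℝ)) N ((a : ℝ) / q + θ)‖ ≤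
      (1 + 2 * π) * W * (Real.sqrt N + Cs * 2 ^ s * N / Real.log N ^ s) := by
  have hq0 : (0 : ℝ) < q := by exact_mod_cast hq
  have hqpos : 0 < q := hq
  have hN0 : (0 : ℝ) < N := by exact_mod_cast (lt_of_lt_of_le (by norm_num) hN)
  set L : ℝ := Real.log N with hL
  have hL0 : 0 < L := by linarith
  have hW0 : 0 < W := lt_of_lt_of_le hq0 hqW
  have hsqN : 0 < Real.sqrt N := Real.sqrt_pos.2 hN0
  -- the uniform bound for the partial sums `V_r(m) = ∑_{n ≤ m, n ≡ r (q)} μ(n)`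
  set E : ℝ := Cs * 2 ^ s * N / L ^ s with hE
  have hE0 : 0 ≤ E := by positivity
  have hV : ∀ r : ℕ, ∀ m : ℕ, m ≤ N →
      ‖∑ n ∈ (Icc 1 m).filter (fun n : ℕ => n % q = r), ((μ n : ℝ) : ℂ)‖ ≤ Real.sqrt N + E := by
    intro r m hmN
    rw [← Complex.ofReal_sum] 
    rw [Complex.norm_real, Real.norm_eq_abs]
    by_cases hm : (m : ℝ) < Real.sqrt N
    · -- trivial bound `≤ m ≤ √N`
      have h1 : |∑ n ∈ (Icc 1 m).filter (fun n : ℕ => n % q = r), (μ n : ℝ)| ≤ m := by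
        refine (Finset.abs_sum_le_sum_abs _ _).trans ?_
        calc ∑ n ∈ (Icc 1 m).filter (fun n : ℕ => n % q = r), |(μ n : ℝ)|
            ≤ ∑ n ∈ (Icc 1 m).filter (fun n : ℕ => n % q = r), (1 : ℝ) :=
              Finset.sum_le_sum fun n _ => by exact_mod_cast abs_moebius_le_one
          _ ≤ ∑ n ∈ Icc 1 m, (1 : ℝ) :=
              Finset.sum_le_sum_of_subset_of_nonneg (Finset.filter_subset _ _)
                fun _ _ _ => zero_le_one
          _ = m := by simp
      linarith
    · -- Siegel–Walfisz at `x = m ≥ √N`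
      have hm' : Real.sqrt N ≤ m := not_lt.mp hm
      have hm2 : (2 : ℝ) ≤ m := by
        have h4 : (2 : ℝ) ≤ Real.sqrt N := by
          rw [show (2 : ℝ) = Real.sqrt 4 by rw [show (4:ℝ) = 2 ^ 2 by norm_num, Real.sqrt_sq (by norm_num)]]
          refine Real.sqrt_le_sqrt ?_
          -- `N ≥ e^4 ≥ 4` from `log N ≥ 4`
          have : Real.exp 4 ≤ N := by
            have := Real.exp_le_exp.mpr hL4
            rwa [Real.exp_log hN0] at this
          have h16 : (4 : ℝ) ≤ Real.exp 4 := by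
            have := Real.add_one_le_exp (4 : ℝ); linarith
          linarith
        linarith
      have hm0 : (0 : ℝ) < m := by linarith
      have hlogm : L / 2 ≤ Real.log m := by
        have : Real.log (Real.sqrt N) = L / 2 := by
          rw [Real.log_sqrt hN0.le, hL]
        rw [← this]
        exact Real.log_le_log hsqN hm'
      have hlogm0 : 0 < Real.log m := by linarith
      have hqm : (q : ℝ) ≤ Real.log m ^ sA := by
        refine hqW.trans (hWs.trans ?_)
        exact Real.rpow_le_rpow (by linarith) hlogm hsA.le
      have hsw := hSW (m : ℝ) hm2 q hq hqm (r : ZMod q)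
      rw [Nat.floor_natCast] at hsw
      have hfilt : (Icc 1 m).filter (fun n : ℕ => (n : ZMod q) = (r : ZMod q)) =
          (Icc 1 m).filter (fun n : ℕ => n % q = r % q) := by
        refine Finset.filter_congr fun n _ => ?_
        exact ZMod.natCast_eq_natCast_iff' n r q
      by_cases hr : r < q
      · rw [Nat.mod_eq_of_lt hr] at hfilt
        rw [hfilt] at hsw
        refine hsw.trans ?_
        -- `Cs m/(log m)^s ≤ Cs N/(L/2)^s = E`
        have h1 : (L / 2) ^ s ≤ Real.log m ^ s := Real.rpow_le_rpow (by linarith) hlogm hs.le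
        have h2 : 0 < (L / 2) ^ s := Real.rpow_pos_of_pos (by linarith) s
        have hmN' : (m : ℝ) ≤ N := by exact_mod_cast hmN
        calc Cs * m / Real.log m ^ s ≤ Cs * N / (L / 2) ^ s := by
              rw [div_le_div_iff₀ (Real.rpow_pos_of_pos hlogm0 s) h2]
              have := mul_le_mul hmN' h1 h2.le hN0.le
              nlinarith
          _ = E := by
              rw [hE, Real.div_rpow hL0.le (by norm_num), div_div_eq_mul_div]
              ring
          _ ≤ Real.sqrt N + E := by linarith [hsqN.le]
      · -- `r ≥ q`: the progression is empty
        have hempty : (Icc 1 m).filter (fun n : ℕ => n % q = r) = ∅ := by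
          refine Finset.filter_eq_empty_iff.mpr fun n _ h => hr ?_
          rw [← h]; exact Nat.mod_lt n hqpos
        rw [hempty, Finset.sum_empty, abs_zero]
        positivity
  -- residue decomposition of the sum
  set T : ℕ → ℂ := fun r => ∑ n ∈ (Icc 1 N).filter (fun n : ℕ => n % q = r),
    ((μ n : ℝ) : ℂ) * (𝐞 ((n : ℝ) * θ) : ℂ) with hT
  have hS : afExpSum (fun n => (μ n : ℝ)) N ((a : ℝ) / q + θ) =
      ∑ r ∈ range q, (𝐞 ((r : ℝ) * ((a : ℝ) / q)) : ℂ) * T r := by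
    unfold afExpSum
    rw [← Finset.sum_fiberwise_of_maps_to (s := Icc 1 N) (t := range q) (g := fun n => n % q)
      (fun n _ => mem_range.mpr (Nat.mod_lt n hqpos))]
    refine Finset.sum_congr rfl fun r _ => ?_
    rw [hT, Finset.mul_sum]
    refine Finset.sum_congr rfl fun n hn => ?_
    rw [(Finset.mem_filter.mp hn).2.symm, fourierChar_mul_rat_add n hq a θ]
    push_cast
    ring
  -- Abel summation on each residue class
  have hTle : ∀ r ∈ range q, ‖T r‖ ≤ (Real.sqrt N + E) * (1 + 2 * π * W / q) := by
    intro r _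
    set c : ℕ → ℂ := fun n => if n % q = r then ((μ n : ℝ) : ℂ) else 0 with hc
    have hTr : T r = ∑ n ∈ Icc 1 N, c n * (𝐞 ((n : ℝ) * θ) : ℂ) := by
      simp only [hT]
      rw [Finset.sum_filter]
      refine Finset.sum_congr rfl fun n _ => ?_
      simp only [hc]
      split_ifs <;> simp
    have hVc : ∀ m, ∑ n ∈ Icc 1 m, c n =
        ∑ n ∈ (Icc 1 m).filter (fun n : ℕ => n % q = r), ((μ n : ℝ) : ℂ) := by
      intro m; rw [hc, Finset.sum_filter]
    rw [hTr]
    have habel := norm_sum_mul_le_of_lipschitz c (fun n => (𝐞 ((n : ℝ) * θ) : ℂ)) N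
      (fun n => (norm_fourierChar _).le)
      (fun m _ _ => (norm_fourierChar_succ_sub_le m θ).trans
        (mul_le_mul_of_nonneg_left hθ (by positivity)))
    refine habel.trans ?_
    simp_rw [hVc]
    have h1 : ‖∑ n ∈ (Icc 1 N).filter (fun n : ℕ => n % q = r), ((μ n : ℝ) : ℂ)‖ ≤
        Real.sqrt N + E := hV r N le_rfl
    have h2 : ∑ m ∈ Ico 1 N, ‖∑ n ∈ (Icc 1 m).filter (fun n : ℕ => n % q = r), ((μ n : ℝ) : ℂ)‖
        ≤ N * (Real.sqrt N + E) := by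
      calc ∑ m ∈ Ico 1 N, ‖∑ n ∈ (Icc 1 m).filter (fun n : ℕ => n % q = r), ((μ n : ℝ) : ℂ)‖
          ≤ ∑ m ∈ Ico 1 N, (Real.sqrt N + E) :=
            Finset.sum_le_sum fun m hm => hV r m (Finset.mem_Ico.mp hm).2.le
        _ = ((N - 1 : ℕ) : ℝ) * (Real.sqrt N + E) := by
            rw [Finset.sum_const, Nat.card_Ico, nsmul_eq_mul]
        _ ≤ N * (Real.sqrt N + E) := by
            refine mul_le_mul_of_nonneg_right ?_ (by positivity)
            exact_mod_cast Nat.sub_le N 1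
    calc ‖∑ n ∈ (Icc 1 N).filter (fun n : ℕ => n % q = r), ((μ n : ℝ) : ℂ)‖ +
          2 * π * (W / (N * q)) * ∑ m ∈ Ico 1 N,
            ‖∑ n ∈ (Icc 1 m).filter (fun n : ℕ => n % q = r), ((μ n : ℝ) : ℂ)‖
        ≤ (Real.sqrt N + E) + 2 * π * (W / (N * q)) * (N * (Real.sqrt N + E)) :=
          add_le_add h1 (mul_le_mul_of_nonneg_left h2 (by positivity))
      _ = (Real.sqrt N + E) * (1 + 2 * π * W / q) := by
          field_simp
  -- sum over the residues
  calc ‖afExpSum (fun n => (μ n : ℝ)) N ((a : ℝ) / q + θ)‖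
      = ‖∑ r ∈ range q, (𝐞 ((r : ℝ) * ((a : ℝ) / q)) : ℂ) * T r‖ := by rw [hS]
    _ ≤ ∑ r ∈ range q, ‖(𝐞 ((r : ℝ) * ((a : ℝ) / q)) : ℂ) * T r‖ := norm_sum_le _ _
    _ ≤ ∑ r ∈ range q, (Real.sqrt N + E) * (1 + 2 * π * W / q) := by
        refine Finset.sum_le_sum fun r hr => ?_
        rw [norm_mul, norm_fourierChar, one_mul]
        exact hTle r hr
    _ = q * ((Real.sqrt N + E) * (1 + 2 * π * W / q)) := by
        rw [Finset.sum_const, Finset.card_range, nsmul_eq_mul]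
    _ = (Real.sqrt N + E) * (q + 2 * π * W) := by
        field_simp
    _ ≤ (Real.sqrt N + E) * (W + 2 * π * W) := by
        refine mul_le_mul_of_nonneg_left (by linarith) (by positivity)
    _ = (1 + 2 * π) * W * (Real.sqrt N + Cs * 2 ^ s * N / Real.log N ^ s) := by
        rw [hE]; ring

/-! ### Davenport's theorem -/

/-- **Davenport's theorem** (Davenport 1937; Green–Tao 2008 §1 Example 3 eq. (mu-alpha), §5):
for every `A > 0` there is `C` such that for all `N ≥ 2` and all real `α`,
`‖∑_{n ≤ N} μ(n) e(nα)‖ ≤ C N/(log N)^A`. The constant is ineffective (Siegel).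
Proof: Dirichlet's theorem with `Q = N/(log N)^{2B'}`, `B' = ⌈A⌉ + 5`; minor arcs by the tree's
Davenport–Vaughan bound `MoebiusExpSum.norm_afExpSum_moebius_le`, major arcs by
`norm_afExpSum_moebius_majorArc_le` with the tree's Siegel–Walfisz theorem for `μ`
(`SiegelWalfiszMoebius_holds`); small `N` by the trivial bound.
[cite: GreenTao2008QuadraticMobius, §1 Example 3 eq. (mu-alpha); §5 (proof)]
[cite: Davenport1937, main theorem (as attributed by Green–Tao, §1 Example 3)] -/
theorem davenport (A : ℝ) (hA : 0 < A) :
    ∃ C : ℝ, ∀ N : ℕ, 2 ≤ N → ∀ α : ℝ,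
      ‖afExpSum (fun n => (μ n : ℝ)) N α‖ ≤ C * N / Real.log N ^ A := by
  -- parameters
  set B' : ℕ := ⌈A⌉₊ + 5 with hB'
  set s : ℝ := A + 2 * B' with hs
  have hs0 : 0 < s := by positivity
  set sA : ℝ := 4 * B' with hsA
  have hsA0 : 0 < sA := by positivity
  -- the Siegel–Walfisz constant
  obtain ⟨Cs₀, hCs₀⟩ := SiegelWalfiszMoebius_holds.logPow hsA0 s
  set Cs : ℝ := max Cs₀ 0 with hCsdef
  have hCs : 0 ≤ Cs := le_max_right _ _
  have hSW : ∀ x : ℝ, 2 ≤ x → ∀ q' : ℕ, 1 ≤ q' → (q' : ℝ) ≤ Real.log x ^ sA → ∀ r : ZMod q',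
      |∑ n ∈ (Icc 1 ⌊x⌋₊).filter (fun n : ℕ => (n : ZMod q') = r), (μ n : ℝ)| ≤
        Cs * x / Real.log x ^ s := by
    intro x hx q' hq' hqx r
    refine (hCs₀ x hx q' hq' hqx r).trans ?_
    have : 0 ≤ x / Real.log x ^ s := by
      have := Real.log_nonneg (by linarith : (1 : ℝ) ≤ x); positivity
    calc Cs₀ * x / Real.log x ^ s = Cs₀ * (x / Real.log x ^ s) := by ring
      _ ≤ Cs * (x / Real.log x ^ s) := mul_le_mul_of_nonneg_right (le_max_left _ _) this
      _ = Cs * x / Real.log x ^ s := by ring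
  -- thresholds in `N`
  have hev : ∀ᶠ N : ℕ in atTop, 4 ≤ Real.log N ∧
      Real.log N ^ (B' : ℝ) ≤ (N : ℝ) ^ (1 / 10 : ℝ) ∧
      8 * Real.log N ^ (A + 2 * B') ≤ (N : ℝ) ^ (1 / 2 : ℝ) := by
    refine (eventually_le_log 4).and
      ((eventually_log_rpow_le_rpow (B' : ℝ) (by norm_num)).and ?_)
    filter_upwards [eventually_le_log 8,
      eventually_log_rpow_le_rpow (A + 2 * B' + 1) (by norm_num : (0 : ℝ) < 1 / 2)] with N h8 h
    refine le_trans ?_ h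
    have hL0 : 0 < Real.log N := by linarith
    rw [Real.rpow_add_one hL0.ne', mul_comm]
    exact mul_le_mul_of_nonneg_left h8 (Real.rpow_nonneg hL0.le _)
  obtain ⟨N₀, hN₀⟩ := eventually_atTop.mp hev
  -- the constant
  set C₁ : ℝ := max 12288 ((1 + 2 * π) * Cs * 2 ^ s + 1) with hC₁
  have hC₁0 : 0 ≤ C₁ := le_trans (by norm_num) (le_max_left _ _)
  refine ⟨max C₁ (Real.log N₀ ^ A), fun N hN α => ?_⟩
  have hN0 : (0 : ℝ) < N := by exact_mod_cast (lt_of_lt_of_le (by norm_num) hN)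
  have hN1 : (1 : ℝ) < N := by exact_mod_cast (lt_of_lt_of_le (by norm_num) hN)
  set L : ℝ := Real.log N with hL
  have hLpos : 0 < L := Real.log_pos hN1
  have hLA : 0 < L ^ A := Real.rpow_pos_of_pos hLpos A
  have htriv : ‖afExpSum (fun n => (μ n : ℝ)) N α‖ ≤ N := norm_afExpSum_moebius_le_self N α
  by_cases hsmall : N < N₀
  · -- trivial regime `N < N₀`
    have h1 : L ^ A ≤ Real.log N₀ ^ A := by
      refine Real.rpow_le_rpow hLpos.le ?_ hA.le
      exact Real.log_le_log hN0 (by exact_mod_cast hsmall.le)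
    rw [le_div_iff₀ hLA]
    calc ‖afExpSum (fun n => (μ n : ℝ)) N α‖ * L ^ A ≤ N * Real.log N₀ ^ A :=
          mul_le_mul htriv h1 hLA.le hN0.le
      _ ≤ max C₁ (Real.log N₀ ^ A) * N := by
          rw [mul_comm]; exact mul_le_mul_of_nonneg_right (le_max_right _ _) hN0.le
  -- main regime: it suffices to prove the bound with `C₁`
  suffices hmain : ‖afExpSum (fun n => (μ n : ℝ)) N α‖ ≤ C₁ * N / L ^ A by
    refine hmain.trans ?_
    rw [mul_div_assoc, mul_div_assoc]
    exact mul_le_mul_of_nonneg_right (le_max_left _ _) (by positivity)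
  obtain ⟨hL4, hL10, hL2⟩ := hN₀ N (not_lt.mp hsmall)
  have hL1 : 1 ≤ L := by linarith
  -- `W = L^{2B'}`
  set W : ℝ := (L ^ B') ^ 2 with hWdef
  have hLB' : 0 < L ^ B' := pow_pos hLpos B'
  have hW0 : 0 < W := by positivity
  have hsqrtW : Real.sqrt W = L ^ B' := by rw [hWdef, Real.sqrt_sq hLB'.le]
  have hW1 : 1 ≤ W := by rw [hWdef]; exact one_le_pow₀ (one_le_pow₀ hL1)
  have hWrpow : W = L ^ ((2 * B' : ℕ) : ℝ) := by
    rw [Real.rpow_natCast, hWdef, ← pow_mul, mul_comm]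
  have hWLA : W * L ^ A = L ^ (A + 2 * B') := by
    rw [hWrpow, ← Real.rpow_add hLpos]; push_cast; ring_nf
  have hLs : L ^ s = L ^ A * W := by
    rw [hs, mul_comm (L ^ A) W, hWLA]
  have hsqrtN : Real.sqrt N = (N : ℝ) ^ (1 / 2 : ℝ) := Real.sqrt_eq_rpow N
  -- `W ≤ 8 L^{A+2B'} ≤ √N ≤ N`
  have hW_le : W ≤ L ^ (A + 2 * B') := by
    rw [hWrpow]
    refine Real.rpow_le_rpow_of_exponent_le hL1 ?_
    push_cast; linarith
  have hsqrtN_le : Real.sqrt N ≤ N := by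
    rw [hsqrtN]
    calc (N : ℝ) ^ (1 / 2 : ℝ) ≤ (N : ℝ) ^ (1 : ℝ) :=
          Real.rpow_le_rpow_of_exponent_le hN1.le (by norm_num)
      _ = N := Real.rpow_one _
  have hWN : W ≤ N := by
    have h8 : L ^ (A + 2 * B') ≤ 8 * L ^ (A + 2 * B') := by
      have := Real.rpow_nonneg hLpos.le (A + 2 * B'); linarith
    rw [← hsqrtN] at hL2
    linarith
  -- Dirichlet's theorem with `Q = ⌊N/W⌋`
  set n : ℕ := ⌊(N : ℝ) / W⌋₊ with hndef
  have hNW1 : 1 ≤ (N : ℝ) / W := by rw [le_div_iff₀ hW0]; linarith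
  have hn1 : 1 ≤ n := Nat.le_floor (by exact_mod_cast hNW1)
  have hnle : (n : ℝ) ≤ N / W := Nat.floor_le (by positivity)
  have hnlt : (N : ℝ) / W < n + 1 := Nat.lt_floor_add_one _
  obtain ⟨r, hr, hrn⟩ := Real.exists_rat_abs_sub_le_and_den_le α hn1
  set q : ℕ := r.den with hqdef
  set a : ℤ := r.num with hadef
  have hq1 : 1 ≤ q := r.den_pos
  have hq0 : (0 : ℝ) < q := by exact_mod_cast hq1
  have hra : (r : ℝ) = a / q := by rw [hadef, hqdef]; exact Rat.cast_def r
  have hcop : IsCoprime a (q : ℤ) := by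
    rw [Int.isCoprime_iff_gcd_eq_one, hadef, hqdef]; exact r.reduced
  have hqn : (q : ℝ) ≤ n := by exact_mod_cast hrn
  have hθ1 : |α - a / q| ≤ 1 / ((n + 1) * q) := by rw [← hra]; exact hr
  have hqNW : (q : ℝ) ≤ N / W := hqn.trans hnle
  by_cases hqW : W < q
  · -- minor arc
    have hα : |α - a / q| ≤ 1 / (q : ℝ) ^ 2 := by
      refine hθ1.trans ?_
      rw [sq]
      refine one_div_le_one_div_of_le (by positivity) ?_
      exact mul_le_mul_of_nonneg_right (by linarith) hq0.le
    have hqN : q ≤ N := by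
      have : (q : ℝ) ≤ N := hqNW.trans (div_le_self hN0.le hW1)
      exact_mod_cast this
    have hV := norm_afExpSum_moebius_le hq1 hcop hα hN hqN
    -- the three terms are `≤ N / L^{B'}`
    have ht1 : (N : ℝ) / Real.sqrt q ≤ N / L ^ B' := by
      rw [← hsqrtW]
      exact div_le_div_of_nonneg_left hN0.le (Real.sqrt_pos.2 hW0)
        (Real.sqrt_le_sqrt hqW.le)
    have ht2 : (N : ℝ) ^ (9 / 10 : ℝ) ≤ N / L ^ B' := by
      rw [le_div_iff₀ hLB']
      have hL10' : L ^ B' ≤ (N : ℝ) ^ (1 / 10 : ℝ) := by rwa [← Real.rpow_natCast]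
      calc (N : ℝ) ^ (9 / 10 : ℝ) * L ^ B' ≤ (N : ℝ) ^ (9 / 10 : ℝ) * (N : ℝ) ^ (1 / 10 : ℝ) :=
            mul_le_mul_of_nonneg_left hL10' (Real.rpow_nonneg hN0.le _)
        _ = N := by rw [← Real.rpow_add hN0]; norm_num
    have ht3 : Real.sqrt N * Real.sqrt q ≤ N / L ^ B' := by
      have h2 : Real.sqrt q ≤ Real.sqrt N / L ^ B' := by
        calc Real.sqrt q ≤ Real.sqrt (N / W) := Real.sqrt_le_sqrt hqNW
          _ = Real.sqrt N / L ^ B' := by rw [Real.sqrt_div hN0.le, hsqrtW]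
      calc Real.sqrt N * Real.sqrt q ≤ Real.sqrt N * (Real.sqrt N / L ^ B') :=
            mul_le_mul_of_nonneg_left h2 (Real.sqrt_nonneg _)
        _ = N / L ^ B' := by rw [mul_div_assoc', Real.mul_self_sqrt hN0.le]
    -- `L^4 / L^{B'} ≤ 1 / L^A`
    have hB'4 : B' = 4 + (B' - 4) := by omega
    have hLAB : L ^ A ≤ L ^ (B' - 4) := by
      rw [← Real.rpow_natCast]
      refine Real.rpow_le_rpow_of_exponent_le hL1 ?_
      have h1 : ((B' - 4 : ℕ) : ℝ) = ⌈A⌉₊ + 1 := by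
        have : B' - 4 = ⌈A⌉₊ + 1 := by omega
        rw [this]; push_cast; ring
      rw [h1]
      have := Nat.le_ceil A
      linarith
    have hLB4 : 0 < L ^ (B' - 4) := pow_pos hLpos _
    calc ‖afExpSum (fun n => (μ n : ℝ)) N α‖
        ≤ 4096 * L ^ 4 * (N / Real.sqrt q + (N : ℝ) ^ (9 / 10 : ℝ) + Real.sqrt N * Real.sqrt q) := hV
      _ ≤ 4096 * L ^ 4 * (3 * (N / L ^ B')) := by
          refine mul_le_mul_of_nonneg_left ?_ (by positivity)
          linarith
      _ = 12288 * N / L ^ (B' - 4) := by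
          rw [hB'4, pow_add, Nat.add_sub_cancel_left]
          field_simp
          ring
      _ ≤ 12288 * N / L ^ A := by
          rw [div_le_div_iff₀ hLB4 hLA]
          exact mul_le_mul_of_nonneg_left hLAB (by positivity)
      _ ≤ C₁ * N / L ^ A := by
          rw [mul_div_assoc, mul_div_assoc]
          exact mul_le_mul_of_nonneg_right (le_max_left _ _) (by positivity)
  · -- major arc
    have hqW' : (q : ℝ) ≤ W := not_lt.mp hqW
    set θ : ℝ := α - a / q with hθdef
    have hαθ : α = (a : ℝ) / q + θ := by rw [hθdef]; ring
    have hθ : |θ| ≤ W / (N * q) := by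
      refine hθ1.trans ?_
      rw [div_le_div_iff₀ (by positivity) (by positivity), one_mul]
      have h2 : (N : ℝ) < W * (n + 1) := by rwa [div_lt_iff₀ hW0, mul_comm] at hnlt
      have h3 : (N : ℝ) * q ≤ W * (n + 1) * q := mul_le_mul_of_nonneg_right h2.le hq0.le
      linarith [h3]
    have hWs : W ≤ (L / 2) ^ sA := by
      have hsA' : sA = ((4 * B' : ℕ) : ℝ) := by rw [hsA]; push_cast; ring
      rw [hsA', Real.rpow_natCast, pow_mul, hWdef, ← pow_mul, mul_comm B' 2, pow_mul]
      refine pow_le_pow_left₀ (by positivity) ?_ B'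
      -- `L² ≤ (L/2)⁴` from `L ≥ 4`
      have h16 : 16 ≤ L ^ 2 := by
        rw [sq]
        exact le_trans (by norm_num : (16 : ℝ) ≤ 4 * 4) (mul_le_mul hL4 hL4 (by norm_num) (by linarith))
      have : (L / 2) ^ 4 = L ^ 2 * L ^ 2 / 16 := by ring
      rw [this, le_div_iff₀ (by norm_num : (0 : ℝ) < 16)]
      exact mul_le_mul_of_nonneg_left h16 (sq_nonneg L)
    have hmaj := norm_afExpSum_moebius_majorArc_le (a := a) hN hL4 hq1 hqW' hθ hs0 hsA0 hCs
      hWs hSW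
    rw [← hαθ] at hmaj
    refine hmaj.trans ?_
    -- `(1 + 2π) W √N ≤ N / L^A`
    have hpi : 1 + 2 * π ≤ 8 := by have := Real.pi_lt_d2; linarith
    have h1 : (1 + 2 * π) * W * Real.sqrt N ≤ N / L ^ A := by
      rw [le_div_iff₀ hLA]
      have h2 : 8 * L ^ (A + 2 * B') * Real.sqrt N ≤ N := by
        rw [← hsqrtN] at hL2
        calc 8 * L ^ (A + 2 * B') * Real.sqrt N ≤ Real.sqrt N * Real.sqrt N :=
              mul_le_mul_of_nonneg_right hL2 (Real.sqrt_nonneg _)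
          _ = N := Real.mul_self_sqrt hN0.le
      calc (1 + 2 * π) * W * Real.sqrt N * L ^ A = (1 + 2 * π) * (W * L ^ A) * Real.sqrt N := by
            ring
        _ ≤ 8 * (W * L ^ A) * Real.sqrt N := by gcongr
        _ = 8 * L ^ (A + 2 * B') * Real.sqrt N := by rw [hWLA]
        _ ≤ N := h2
    -- `(1 + 2π) W Cs 2^s N / L^s = (1 + 2π) Cs 2^s N / L^A`
    have h2 : (1 + 2 * π) * W * (Cs * 2 ^ s * N / L ^ s) = (1 + 2 * π) * Cs * 2 ^ s * N / L ^ A := by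
      rw [hLs]
      field_simp
    calc (1 + 2 * π) * W * (Real.sqrt N + Cs * 2 ^ s * N / L ^ s)
        = (1 + 2 * π) * W * Real.sqrt N + (1 + 2 * π) * W * (Cs * 2 ^ s * N / L ^ s) := by ring
      _ ≤ N / L ^ A + (1 + 2 * π) * Cs * 2 ^ s * N / L ^ A := by rw [h2]; exact add_le_add h1 le_rfl
      _ = ((1 + 2 * π) * Cs * 2 ^ s + 1) * N / L ^ A := by ring
      _ ≤ C₁ * N / L ^ A := by
          rw [mul_div_assoc, mul_div_assoc]
          exact mul_le_mul_of_nonneg_right (le_max_right _ _) (by positivity)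

/-! ### Davenport's theorem in arithmetic progressions, uniformly in the modulus -/

/-- **Davenport's bound restricted to a progression, uniformly in the modulus**: for every
`A > 0` there is `C` such that for all `N ≥ 2`, `q ≥ 1`, all residues `r` and all real `α`,
`‖∑_{n ≤ N, n ≡ r (q)} μ(n) e(nα)‖ ≤ C N/(log N)^A` (here `n ≡ r (q)` means `n mod q = r`; for
`r ≥ q` the sum is empty). Proof: detect the progression with the `q` additive characters mod `q`
(`sum_filter_mod_eq_sum_twist`); each twisted sum is a Davenport sum at the frequency `α + c/q`.
This is the linear ("AP-restricted") input of the major-arc analysis for quadratic phases,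
Green–Tao 2008 Prop. 18 / §7 (there via the Fourier expansion of the `q`-periodic `e(an²/q)`).
[cite: GreenTao2008QuadraticMobius, §7 Proposition 18 (proof: linear Möbius sums twisted mod q)] -/
theorem davenport_progression (A : ℝ) (hA : 0 < A) :
    ∃ C : ℝ, ∀ N : ℕ, 2 ≤ N → ∀ q : ℕ, 1 ≤ q → ∀ r : ℕ, ∀ α : ℝ,
      ‖∑ n ∈ (Icc 1 N).filter (fun n : ℕ => n % q = r),
          ((μ n : ℝ) : ℂ) * (𝐞 ((n : ℝ) * α) : ℂ)‖ ≤ C * N / Real.log N ^ A := by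
  obtain ⟨C, hC⟩ := davenport A hA
  refine ⟨max C 0, fun N hN q hq r α => ?_⟩
  have hN1 : (1 : ℝ) < N := by exact_mod_cast (lt_of_lt_of_le (by norm_num) hN)
  have hN0 : (0 : ℝ) ≤ N := by linarith
  have hLA : 0 < Real.log N ^ A := Real.rpow_pos_of_pos (Real.log_pos hN1) A
  have hbound : 0 ≤ max C 0 * N / Real.log N ^ A := by positivity
  have hq0 : (0 : ℝ) < q := by exact_mod_cast hq
  by_cases hr : r < q
  swap
  · have hempty : (Icc 1 N).filter (fun n : ℕ => n % q = r) = ∅ := by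
      refine Finset.filter_eq_empty_iff.mpr fun n _ h => hr ?_
      rw [← h]; exact Nat.mod_lt n hq
    rw [hempty, Finset.sum_empty, norm_zero]
    exact hbound
  have key := sum_filter_mod_eq_sum_twist (Icc 1 N) hq r
    (fun n => ((μ n : ℝ) : ℂ) * (𝐞 ((n : ℝ) * α) : ℂ))
  rw [Nat.mod_eq_of_lt hr] at key
  rw [key, norm_mul, norm_inv, Complex.norm_natCast]
  -- each twisted sum is a Davenport sum at frequency `α + c/q`
  have hinner : ∀ c ∈ range q,
      ‖(𝐞 (-((c : ℝ) * ((r : ℝ) / q))) : ℂ) *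
        ∑ n ∈ Icc 1 N, ((μ n : ℝ) : ℂ) * (𝐞 ((n : ℝ) * α) : ℂ) * (𝐞 ((c : ℝ) * ((n : ℝ) / q)) : ℂ)‖
        ≤ max C 0 * N / Real.log N ^ A := by
    intro c _
    rw [norm_mul, norm_fourierChar, one_mul]
    have heq : ∑ n ∈ Icc 1 N, ((μ n : ℝ) : ℂ) * (𝐞 ((n : ℝ) * α) : ℂ) *
        (𝐞 ((c : ℝ) * ((n : ℝ) / q)) : ℂ) = afExpSum (fun n => (μ n : ℝ)) N (α + c / q) := by
      unfold afExpSum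
      refine Finset.sum_congr rfl fun n _ => ?_
      have : (n : ℝ) * (α + c / q) = (n : ℝ) * α + (c : ℝ) * ((n : ℝ) / q) := by ring
      rw [this, AddChar.map_add_eq_mul, Circle.coe_mul]
      push_cast
      ring
    rw [heq]
    refine (hC N hN (α + c / q)).trans ?_
    rw [mul_div_assoc, mul_div_assoc]
    exact mul_le_mul_of_nonneg_right (le_max_left _ _) (by positivity)
  calc (q : ℝ)⁻¹ * ‖∑ c ∈ range q, (𝐞 (-((c : ℝ) * ((r : ℝ) / q))) : ℂ) *
        ∑ n ∈ Icc 1 N, ((μ n : ℝ) : ℂ) * (𝐞 ((n : ℝ) * α) : ℂ) * (𝐞 ((c : ℝ) * ((n : ℝ) / q)) : ℂ)‖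
      ≤ (q : ℝ)⁻¹ * ∑ c ∈ range q, (max C 0 * N / Real.log N ^ A) := by
        refine mul_le_mul_of_nonneg_left ((norm_sum_le _ _).trans (Finset.sum_le_sum hinner))
          (by positivity)
    _ = max C 0 * N / Real.log N ^ A := by
        rw [Finset.sum_const, Finset.card_range, nsmul_eq_mul]
        field_simp

end Literature.NumberTheory.Sieve.MoebiusDavenport
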